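import Summits.ResolutionOfSingularities.ResolutionOfSingularities.Theorems.DescentDescentPerfectToAllFgModel
import Summits.ResolutionOfSingularities.ResolutionOfSingularities.Theorems.DescentDescentPerfectToAllLevelResolution
import Summits.ResolutionOfSingularities.ResolutionOfSingularities.Theorems.DescentDescentPerfectToAllRobustSeparable
import Summits.ResolutionOfSingularities.ResolutionOfSingularities.Theorems.DescentDescentPerfectToAllFiniteLevels
import Summits.ResolutionOfSingularities.ResolutionOfSingularities.Theorems.DescentDescentPerfectToAllRobustModel
import Mathlib.FieldTheory.PurelyInseparable.PerfectClosure

/-!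
# `DescentPerfectToAll` (stmt-ResolutionOfSingularities-0549) holds for ground fields separably algebraic
# over a finitely generated subfield

Route `ResolutionOfSingularities/Descent`, crux `DescentPerfectToAll` (perfect fields ⇒ all fields of
characteristic `p`). Helper (OURS; not a statement of any manuscript). The tree proves the crux's conclusion
for every ground field `k` that is *separably exhausted* by finitely generated subfields
(`hasResolution_of_perfectRes_of_separablyExhausted`, `DescentDescentPerfectToAllReduction.lean`: every finite
subset of `k` lies in a finitely generated `L ⊆ k` over which `k` is separable in MacLane's sense —
`L`-linearly independent finite families have `L`-linearly independent `p`-th powers). This file supplies the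
natural algebraic sufficient condition and so a NEW unconditional case of the crux, in all dimensions:

* `linearIndepOn_pow_of_isSeparable` — if `k` is separable ALGEBRAIC over a subfield `L`
  (`Algebra.IsSeparable L k`), MacLane's condition holds over `L` (Mathlib:
  `LinearIndependent.map_pow_expChar_pow_of_isSeparable`, i.e. `E = F(E^p)` for separable `E/F`).
* `hasResolution_of_perfectRes_of_isSeparable_fg` — **if every reduced separated scheme of finite type over
  every perfect field of characteristic `p` has a resolution, then so does every reduced separated scheme of
  finite type over every field `k` of characteristic `p` that is separable algebraic over some finitely
  generated subfield `L₀ = closure s₀`** (e.g. `k` finitely generated; `k` a separable closure of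
  `𝔽_p(t₁,…,tₙ)`; any separable algebraic extension of a finitely generated field — all of infinite
  `p`-rank issues aside, these are exactly the fields reached by the generic-fibre-plus-separable-base-change
  mechanism).
* `descentPerfectToAll_isSeparableFg` — the same in the binder shape of the crux with the two extra
  hypotheses on `k` inserted.

What this does NOT reach (the residual of stmt-0549, unchanged): ground fields that are not separable over
any finitely generated field of definition, e.g. `𝔽_p(t)(u^{1/p^∞})` or `𝔽_p((t))` (MacLane obstruction;
tree barrier `Literature.Barriers.ResolutionOfSingularities.InseparableBaseChangeResolution`, Narrow audit).
-/

noncomputable section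

set_option linter.dupNamespace false -- mandated namespace of this single-conjunct summit

open CategoryTheory CategoryTheory.Limits AlgebraicGeometry
open Literature.AlgebraicGeometry.Resolution

namespace Summit.ResolutionOfSingularities.ResolutionOfSingularities.Theorems

/-- **Separable algebraic extensions satisfy MacLane's criterion**: if `k` is separable algebraic over the
subfield `L` (characteristic `p`), then every `L`-linearly independent finite family in `k` has `L`-linearly
independent `p`-th powers (for `E/F` separable, `E = F(E^p)`; Mathlib's
`LinearIndependent.map_pow_expChar_pow_of_isSeparable`). [folklore] -/
theorem linearIndepOn_pow_of_isSeparable {p : ℕ} [Fact p.Prime] {k : Type} [Field k] [CharP k p]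
    (L : Subfield k) [Algebra.IsSeparable L k] (u : Finset k)
    (hu : LinearIndepOn L _root_.id (↑u : Set k)) : LinearIndepOn L (fun x : k => x ^ p) (↑u : Set k) := by
  haveI : CharP L p := (algebraMap L k).charP Subtype.val_injective p
  haveI : ExpChar L p := ExpChar.prime (Fact.out : p.Prime)
  have h := hu.map_pow_expChar_pow_of_isSeparable (E := k) p 1
  simp only [pow_one, id] at h
  exact h

/-- **Resolution over perfect fields ⇒ resolution over every field separable algebraic over a finitely
generated subfield** (characteristic `p`): such a field is separably exhausted by the finitely generated
subfields `closure (s₀ ∪ s)`, over each of which it is again separable algebraic; then the chain of the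
landed stubs of the line `arc-special-fibre-transversality` (field of definition `stub_fgModel`, resolutions at
finitely generated levels `stub_levelResolution`, a robust separable level `stub_robustLevelSeparable`,
regularity of the limit `stub_regularOfFiniteLevels`, base change `stub_resolutionOfRobustModel`) — the proof of
`hasResolution_of_perfectRes_of_separablyExhausted` (`DescentDescentPerfectToAllReduction.lean`), inlined so
that this file does not import the route file. [folklore] -/
theorem hasResolution_of_perfectRes_of_isSeparable_fg (p : ℕ) [Fact p.Prime]
    (H : ∀ (κ : Type) [Field κ] [CharP κ p] [PerfectField κ] (Z : Scheme.{0}) (h : Z ⟶ Spec (.of κ)),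
      IsSeparated h → LocallyOfFiniteType h → QuasiCompact h → IsReduced Z → Scheme.HasResolution Z)
    (k : Type) [Field k] [CharP k p] (L₀ : Subfield k) (s₀ : Finset k)
    (hL₀ : L₀ = Subfield.closure (↑s₀ : Set k)) [Algebra.IsSeparable L₀ k]
    (X : Scheme.{0}) (f : X ⟶ Spec (.of k)) [IsSeparated f] [LocallyOfFiniteType f] [QuasiCompact f]
    [IsReduced X] : Scheme.HasResolution X := by
  classical
  -- finitely generated field of definition (`stub_fgModel`)
  obtain ⟨K₀, s, hK₀, X₀, f₀, h₁, h₂, h₃, h₄, ⟨e⟩⟩ := stub_fgModel k X f ‹_› ‹_› ‹_› ‹_›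
  have hredb : IsReduced (pullback f₀ (Spec.map (CommRingCat.ofHom K₀.subtype))) :=
    isReduced_of_isOpenImmersion e.inv
  -- the finitely generated level `L = closure (s₀ ∪ s) ⊇ K₀, L₀`, over which `k` is separable algebraic
  set L : Subfield k := Subfield.closure (↑(s₀ ∪ s) : Set k) with hLdef
  have hle : L₀ ≤ L := by
    rw [hL₀]
    exact Subfield.closure_mono fun x hx =>
      Finset.mem_coe.2 (Finset.mem_union_left _ (Finset.mem_coe.1 hx))
  have hL : K₀ ≤ L := by
    rw [hK₀]
    exact Subfield.closure_mono fun x hx =>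
      Finset.mem_coe.2 (Finset.mem_union_right _ (Finset.mem_coe.1 hx))
  have hML : ∀ u : Finset k, LinearIndepOn L _root_.id (↑u : Set k) →
      LinearIndepOn L (fun x : k => x ^ p) (↑u : Set k) := by
    letI : Algebra L₀ L := (Subfield.inclusion hle).toAlgebra
    haveI : IsScalarTower L₀ L k := IsScalarTower.of_algebraMap_eq fun _ => rfl
    haveI : Algebra.IsSeparable L k := Algebra.isSeparable_tower_top_of_isSeparable L₀ L k
    exact fun u hu => linearIndepOn_pow_of_isSeparable L u hu
  -- resolutions at every finitely generated level, a robust separable level, regularity of the limit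
  have hlev := stub_levelResolution p (fun κ _ _ _ Z h a b c d => H κ Z h a b c d) k
  obtain ⟨L₁, hL₁, t₁, hLt₁, Y, π, hπp, hπb, hrob⟩ :=
    stub_robustLevelSeparable p k hlev K₀ s hK₀ X₀ f₀ h₁ h₂ h₃ h₄ hredb ⟨L, hL, s₀ ∪ s, rfl, hML⟩
  haveI := h₁; haveI := h₂; haveI := h₃; haveI := hπp
  have hreg : Scheme.IsRegular (pullback (π ≫ pullback.snd f₀ (Spec.map (CommRingCat.ofHom
      (Subfield.inclusion hL₁)))) (Spec.map (CommRingCat.ofHom L₁.subtype))) :=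
    stub_regularOfFiniteLevels k L₁ t₁ hLt₁ Y _ inferInstance inferInstance hrob
  exact (stub_resolutionOfRobustModel k K₀ L₁ hL₁ X₀ f₀ h₁ h₂ h₃ Y π hπp hπb hreg).of_iso e.inv

/-- **The crux `DescentPerfectToAll` restricted to ground fields separable algebraic over a finitely generated
subfield, proved** (binder shape of stmt-0549 with the hypotheses `L₀ = closure s₀`,
`Algebra.IsSeparable L₀ k` inserted). [folklore] -/
theorem descentPerfectToAll_isSeparableFg :
    ∀ p : ℕ, p.Prime → (∀ (k : Type) [Field k] [CharP k p] [PerfectField k] (X : Scheme.{0})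
      (f : X ⟶ Spec (.of k)), IsSeparated f → LocallyOfFiniteType f → QuasiCompact f →
        IsReduced X → Scheme.HasResolution X) →
    ∀ (k : Type) [Field k] [CharP k p] (L₀ : Subfield k) (s₀ : Finset k),
      L₀ = Subfield.closure (↑s₀ : Set k) → Algebra.IsSeparable L₀ k →
      ∀ (X : Scheme.{0}) (f : X ⟶ Spec (.of k)),
        IsSeparated f → LocallyOfFiniteType f → QuasiCompact f → IsReduced X →
          Scheme.HasResolution X := by
  intro p hp H k _ _ L₀ s₀ hL₀ hsep X f _ _ _ _
  haveI : Fact p.Prime := ⟨hp⟩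
  exact hasResolution_of_perfectRes_of_isSeparable_fg p (fun κ _ _ _ Z h a b c d => H κ Z h a b c d)
    k L₀ s₀ hL₀ X f

end Summit.ResolutionOfSingularities.ResolutionOfSingularities.Theorems

end
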